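import Literature.Geometry.Kaehler.ComplexTorusHodgeGroupCommutativeComplexPoints
import Literature.RingTheory.SimpleModule.CommutantAdjointStableEtale
import HarnessLib

/-!
# A complex torus of CM type carries a ROSATI-STABLE commutative semisimple `T ⊆ End_ℚ(X)` of dimension `2g`,
# for every polarisation («a CM-algebra invariant under the Rosati involution»; Milne, *Complex Multiplication*,
# Ch. I §3 Prop. 3.6 (c), Exercise 3.10 (b)) — torus level

Family `hodge`, lane `lit-hodgefound` (Track 2 foundations library, Layer A3), seat `skel-3`, row **A3-G137**
(FILE 2 of 3: torus level). Layer `Literature/Geometry/Kaehler`, namespace `Literature.Geometry.Kaehler.ComplexTorus`.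
Sequel, BY NAME (nothing restated), of

* `ComplexTorusHodgeGroupCommutative.lean` §4 (`centralizer_le_endAlgRat_of_jMatrix_mem_span`,
  `jMatrix_mem_span_centralizer_endAlgRat`, `jMatrix_mem_span_map_ratCast`, `centralizer_eq_self_of_comm_isReduced`:
  for `T ⊆ End_ℚ(X)` commutative reduced of dimension `2g`, `J ∈ T ⊗ ℝ`, the rational centraliser `Z` of
  `End_ℚ(X)` lies in `T`, and `C(Z) ⊆ End_ℚ(X)`), `ComplexTorusHodgeGroupCommutativeComplexPoints.lean`
  (Prop. 7.2.6 on complex points, `IsRiemannForm.hodgeGroupC_comm_iff_exists_comm_isReduced_le_endAlgRat`) and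
  `ComplexTorusRosati.lean` (`rosati G A = G⁻¹ ᵗA G`, `rosati_mul`, `rosati_rosati`, `dotProduct_mulVec_rosati`,
  `rosati_mem_endAlgRat`);
* this seat's `RingTheory/SimpleModule/CommutantAdjointStableEtale.lean` (FILE 1: the adjoint-stable maximal
  étale subalgebra of `End_Z(V)`, `Commutant.exists_subalgebra_comm_reduced_finrank_eq_adjoint_stable`).

THEOREMS ONLY (no definition, no named fact, no instance, no notation; D-0026, net debt 0).

## Source, verbatim

J. S. Milne, *Complex Multiplication* (course notes, version of July 14, 2020; bib `MilneCM2006`), Ch. I §3 (p. 28):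
**Proposition 3.6 (c)** «An abelian variety `A` has complex multiplication if and only if `End⁰(A)` contains an
étale `ℚ`-algebra (which can be chosen to be a CM-algebra invariant under some Rosati involution) of degree
`2 dim A` over `ℚ`»; **Exercise 3.10 (b)** (p. 29) «Let `′` be a Rosati involution on `End⁰(A)` stabilizing `L`;
show that, if `A` has complex multiplication, then there is an `R` as in (a) [a semisimple commutative
`ℚ`-subalgebra of `End⁰_L(A)` with `dim_ℚ R = (2 dim A)/d`] that is stabilized by `′`» — taken with `L = ℚ`
(`d = 1`), i.e. for EVERY Rosati involution of `End⁰(A)`. Also §1 Prop. 1.39 / Cor. 1.40 (a commutative `ℚ`-algebra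
with positive involution is a product of totally real fields with `id` and CM fields with complex conjugation).

## What is proved (`X = E/Φ(ℤ^ι)`, `End_ℚ(X) = endAlgRat Φ ⊆ M_ι(ℚ)`, `A ↦ A† = rosati G A = G⁻¹ ᵗA G`)

For a rational matrix `G` with `ᵗG = -G`, `det G ≠ 0` under whose involution `†` the algebra `End_ℚ(X)` is stable
(every rational Gram matrix of a form of type `(1,1)` with `η(iu, u) > 0`, Lemma 2.4.1 = the tree's
`rosati_mem_endAlgRat`; in particular every polarisation):

* §1 (private tools) `†` maps the rational centraliser (= centre) `Z` of `End_ℚ(X)` to itself (the abstract form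
  of the tree's `IsRiemannForm.rosati_mem_centralizer_endAlgRat`); `†` is the adjoint for `B(x, y) = ᵗx G y`
  (Prop. 2.4.2 (a), the tree's `dotProduct_mulVec_rosati`).
* §2 ★★ **`exists_comm_isReduced_rosati_stable_le_endAlgRat`** — if `End_ℚ(X)` contains a commutative reduced
  (= semisimple) `ℚ`-subalgebra of dimension `2g = #ι` (Lange's (ii), «of CM-type»), then it contains one which is
  moreover STABLE UNDER `†` («invariant under the Rosati involution», Exercise 3.10 (b) with `L = ℚ`). Proof: for
  `T` as in (ii), `J ∈ T ⊗ ℝ`, so the rational centraliser `Z` of `E = End_ℚ(X)` lies in `C(T) = T ⊆ E` — it is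
  the centre of `E`, commutative, reduced, `†`-stable — and `C(Z) ⊆ E` (`J ∈ Z ⊗ ℝ`); FILE 1 applied to the
  `Z`-module `V = ℚ^ι` with the form `ᵗx G y` gives a `†`-stable commutative reduced `R ⊆ End_Z(V) = C(Z) ⊆ E` of
  dimension `dim V`.
  `exists_comm_isReduced_rosati_stable_le_endAlgRat_iff` (the two conditions are equivalent).
* §3 for a polarised torus: `IsRiemannForm.exists_comm_isReduced_rosati_stable_le_endAlgRat` (any rational Gram
  matrix `G` of the Riemann form `η`), ★ **`IsRiemannForm.hodgeGroupC_comm_iff_exists_rosati_stable`** (Prop. 7.2.6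
  with the Rosati clause: `Hg(X)(ℂ)` is commutative iff `End_ℚ(X)` contains a `†_η`-STABLE commutative semisimple
  subalgebra of dimension `2g`), `IsRiemannForm.jMatrix_mem_span_iff_exists_rosati_stable` (iff `J ∈ End_ℚ(X) ⊗ ℝ`).

That the stable algebra is then a product of CM fields on which `†` is complex conjugation (Prop. 1.39 / Deligne
I 5.1) is the tree's `ComplexTorusRosatiCM.lean` / `CMAlgebraTorusRosati.lean` and, on `𝔥_n`, the Siegel sequel
(FILE 3, `NumberTheory/ComplexMultiplication/SiegelCMPointsCMTypeLocus.lean`).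

## References

* [MilneCM2006] J. S. Milne, *Complex Multiplication* (version July 14, 2020), Ch. I §3 Prop. 3.6 (c),
  Exercise 3.10 (b); §1 Prop. 1.39, Cor. 1.40.
* [Lange2023AbelianVarietiesComplex] H. Lange, *Abelian Varieties over the Complex Numbers* (2023), §2.4.1 Lemma 2.4.1,
  Prop. 2.4.2 (a); §7.2.3 Prop. 7.2.6.
* [Deligne1982HodgeCycles] P. Deligne, *Hodge cycles on abelian varieties*, LNM 900 (1982), I §5 Prop. 5.1 (proof).

## Provenance

Lane `lit-hodgefound`, seat `literature-prover-lit-hodgefound-skel-3-g53-0` (row A3-G137, FILE 2).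
-/

noncomputable section

open scoped Classical
open Module Matrix

namespace Literature.Geometry.Kaehler

namespace ComplexTorus

variable {ι : Type*} [Fintype ι] [DecidableEq ι] {E : Type*} [NormedAddCommGroup E] [NormedSpace ℂ E]
  (Φ : (ι → ℝ) ≃L[ℝ] E)

/-! ## §1 The Rosati involution on the centre of `End_ℚ(X)`; `†` as the adjoint of `ᵗx G y` -/

/-- `†` maps the rational centraliser of `End_ℚ(X)` to itself: if `End_ℚ(X)` is `†`-stable and `z` commutes with
every endomorphism, so does `z†` (`†` is an anti-involution). The abstract-`G` form of the tree's
`IsRiemannForm.rosati_mem_centralizer_endAlgRat` (`ComplexTorusCentralizerSkewForms.lean`, Milne 1999 §1 «`C(A)` is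
stable under the involution `†`»), needed here before a Riemann form is chosen. [folklore] -/
private theorem rosati_mem_centralizer_of_forall_rosati_mem {G : Matrix ι ι ℚ} (hG : IsUnit G.det)
    (hGt : G.transpose = -G)
    (hE : ∀ a ∈ endAlgRat Φ, rosati G a ∈ endAlgRat Φ) {z : Matrix ι ι ℚ}
    (hz : z ∈ Subalgebra.centralizer ℚ (endAlgRat Φ : Set (Matrix ι ι ℚ))) :
    rosati G z ∈ Subalgebra.centralizer ℚ (endAlgRat Φ : Set (Matrix ι ι ℚ)) := by
  rw [Subalgebra.mem_centralizer_iff] at hz ⊢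
  intro a ha
  have h := congrArg (rosati G) (hz (rosati G a) (hE a ha))
  rw [rosati_mul hG, rosati_mul hG, rosati_rosati hG hGt] at h
  exact h.symm

omit [DecidableEq ι] in
/-- Prop. 2.4.2 (a), `B(Ax, y) = B(x, A†y)` for `B(x, y) = ᵗx G y` — the tree's `dotProduct_mulVec_rosati` phrased
for Mathlib's `Matrix.toBilin'`. [folklore] -/
private theorem toBilin_apply_mulVec_eq [DecidableEq ι] {G : Matrix ι ι ℚ} (hG : IsUnit G.det) (A : Matrix ι ι ℚ)
    (x y : ι → ℚ) : Matrix.toBilin' G (A *ᵥ x) y = Matrix.toBilin' G x (rosati G A *ᵥ y) := by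
  rw [Matrix.toBilin'_apply', Matrix.toBilin'_apply', dotProduct_mulVec_rosati hG]

omit [DecidableEq ι] in
/-- For an alternating `G` the form `ᵗx G y` is antisymmetric, hence reflexive. [folklore] -/
private theorem toBilin_isRefl [DecidableEq ι] {G : Matrix ι ι ℚ} (hGt : G.transpose = -G) :
    (Matrix.toBilin' G).IsRefl := by
  intro x y h
  rw [Matrix.toBilin'_apply'] at h ⊢
  rw [Matrix.dotProduct_mulVec, ← Matrix.mulVec_transpose, hGt, Matrix.neg_mulVec, dotProduct_comm,
    dotProduct_neg, h, neg_zero]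

/-! ## §2 A Rosati-stable commutative semisimple subalgebra of dimension `2g` -/

/-- ★★ **EXERCISE 3.10 (b) OF MILNE'S *COMPLEX MULTIPLICATION* (with `L = ℚ`), TORUS LEVEL: a complex torus whose
endomorphism algebra contains a commutative semisimple `ℚ`-algebra of dimension `2g` («of CM-type», Lange's
Prop. 7.2.6 (ii)) contains one which is STABLE UNDER THE ROSATI INVOLUTION `A ↦ G⁻¹ ᵗA G`** of any alternating
non-degenerate rational `G` for which `End_ℚ(X)` is `†`-stable (every polarisation) — «an étale `ℚ`-algebra (which
can be chosen to be a CM-algebra invariant under some Rosati involution) of degree `2 dim A`», for EVERY Rosati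
involution. Proof: the rational centraliser `Z` of `E = End_ℚ(X)` is its centre, commutative, reduced and
`†`-stable, `E ⊇ C(Z) = End_Z(V)` (`J ∈ Z ⊗ ℝ`), and FILE 1's adjoint-stable maximal étale subalgebra of `End_Z(V)`
for the form `ᵗx G y` is the required algebra. [cite: MilneCM2006, Ch. I §3 Exercise 3.10 (b) and Prop. 3.6 (c)]
[cite: Lange2023AbelianVarietiesComplex, §7.2.3 Prop. 7.2.6] -/
theorem exists_comm_isReduced_rosati_stable_le_endAlgRat {G : Matrix ι ι ℚ} (hG : IsUnit G.det)
    (hGt : G.transpose = -G) (hE : ∀ a ∈ endAlgRat Φ, rosati G a ∈ endAlgRat Φ)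
    (hex : ∃ T : Subalgebra ℚ (Matrix ι ι ℚ), T ≤ endAlgRat Φ ∧ IsReduced T ∧ (∀ a ∈ T, ∀ b ∈ T, a * b = b * a) ∧
      finrank ℚ T = Fintype.card ι) :
    ∃ T : Subalgebra ℚ (Matrix ι ι ℚ), T ≤ endAlgRat Φ ∧ IsReduced T ∧ (∀ a ∈ T, ∀ b ∈ T, a * b = b * a) ∧
      finrank ℚ T = Fintype.card ι ∧ ∀ a ∈ T, rosati G a ∈ T := by
  obtain ⟨T, hTE, hTred, hTcomm, hTdim⟩ := hex
  haveI := hTred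
  -- the rational centraliser `Z` of `E = End_ℚ(X)`: `Z ⊆ C(T) = T ⊆ E`, commutative, reduced, `J ∈ Z ⊗ ℝ`, `†`-stable
  set Zc : Subalgebra ℚ (Matrix ι ι ℚ) := Subalgebra.centralizer ℚ (endAlgRat Φ : Set (Matrix ι ι ℚ)) with hZc
  have hZT : Zc ≤ T := by
    intro z hz
    rw [← centralizer_eq_self_of_comm_isReduced T hTcomm hTdim, Subalgebra.mem_centralizer_iff]
    exact fun t ht ↦ (Subalgebra.mem_centralizer_iff ℚ).1 hz t (hTE ht)
  have hZE : Zc ≤ endAlgRat Φ := hZT.trans hTE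
  have hZcomm : ∀ a ∈ Zc, ∀ b ∈ Zc, a * b = b * a := fun a ha b hb ↦
    (Subalgebra.mem_centralizer_iff ℚ).1 hb a (hZE ha)
  have hJZ := jMatrix_mem_span_centralizer_endAlgRat Φ
  haveI hZred : IsReduced Zc := by
    refine ⟨fun z hzn ↦ ?_⟩
    obtain ⟨n, hn⟩ := hzn
    have hz' : (⟨(z : Matrix ι ι ℚ), hZT z.2⟩ : T) = 0 := by
      refine IsReduced.eq_zero _ ⟨n, Subtype.ext ?_⟩
      have h := congrArg (fun x : Zc ↦ (x : Matrix ι ι ℚ)) hn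
      simpa using h
    exact Subtype.ext (by simpa using congrArg (fun x : T ↦ (x : Matrix ι ι ℚ)) hz')
  have hZrosati : ∀ z ∈ Zc, rosati G z ∈ Zc := fun z hz ↦ rosati_mem_centralizer_of_forall_rosati_mem Φ hG hGt hE hz
  -- `Z` as a commutative ring acting on `V = ℚ^ι`
  letI : CommRing Zc :=
    { (inferInstance : Ring Zc) with mul_comm := fun x y ↦ Subtype.ext (hZcomm x x.2 y y.2) }
  let φ : Zc →+* Module.End ℚ (ι → ℚ) :=
    { toFun := fun t ↦ Matrix.toLin' (t : Matrix ι ι ℚ)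
      map_one' := by rw [OneMemClass.coe_one, Matrix.toLin'_one]; rfl
      map_mul' := fun s t ↦ by rw [MulMemClass.coe_mul, Matrix.toLin'_mul]; rfl
      map_zero' := by rw [ZeroMemClass.coe_zero, map_zero]
      map_add' := fun s t ↦ by rw [AddMemClass.coe_add, map_add] }
  letI : Module Zc (ι → ℚ) := Module.compHom _ φ
  have hsmul : ∀ (t : Zc) (v : ι → ℚ), t • v = (t : Matrix ι ι ℚ) *ᵥ v := fun t v ↦ Matrix.toLin'_apply _ _
  haveI : IsScalarTower ℚ Zc (ι → ℚ) := ⟨fun q t v ↦ by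
    rw [hsmul, hsmul, Subalgebra.coe_smul, Matrix.smul_mulVec]⟩
  -- the form `B(x, y) = ᵗx G y`: non-degenerate, reflexive, `Z` adjointable (`z ↦ z†`)
  have hBnd : (Matrix.toBilin' G).Nondegenerate :=
    Matrix.nondegenerate_toBilin'_iff.2 (Matrix.nondegenerate_iff_det_ne_zero.2 hG.ne_zero)
  have hBr : (Matrix.toBilin' G).IsRefl := toBilin_isRefl hGt
  have hBZ : ∀ z : Zc, ∃ z' : Zc, ∀ v w : ι → ℚ,
      Matrix.toBilin' G (z • v) w = Matrix.toBilin' G v (z' • w) := by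
    intro z
    refine ⟨⟨rosati G z, hZrosati z z.2⟩, fun v w ↦ ?_⟩
    rw [hsmul, hsmul, toBilin_apply_mulVec_eq hG]
  -- FILE 1: an adjoint-stable commutative reduced `R ⊆ End_Z(V)` of dimension `dim V`
  obtain ⟨R, hRZ, hRcomm, hRred, hRdim, hRadj⟩ :=
    Literature.RingTheory.SimpleModule.Commutant.exists_subalgebra_comm_reduced_finrank_eq_adjoint_stable
      (F := ℚ) (Z := Zc) (V := ι → ℚ) (Matrix.toBilin' G) hBnd hBr hBZ
  -- transport `R ⊆ End(V)` to matrices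
  let e : Module.End ℚ (ι → ℚ) ≃ₐ[ℚ] Matrix ι ι ℚ := LinearMap.toMatrixAlgEquiv'
  have he : ∀ (f : Module.End ℚ (ι → ℚ)) (v : ι → ℚ), e f *ᵥ v = f v := fun f v ↦
    LinearMap.toMatrix'_mulVec f v
  let T' : Subalgebra ℚ (Matrix ι ι ℚ) := R.map (e : Module.End ℚ (ι → ℚ) →ₐ[ℚ] Matrix ι ι ℚ)
  have hmemT' : ∀ {y : Matrix ι ι ℚ}, y ∈ T' ↔ ∃ x ∈ R, e x = y := fun {y} ↦ Subalgebra.mem_map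
  refine ⟨T', ?_, ?_, ?_, ?_, ?_⟩
  · -- `T' ⊆ C(Z) ⊆ E`
    intro y hy
    obtain ⟨x, hx, rfl⟩ := hmemT'.1 hy
    refine centralizer_le_endAlgRat_of_jMatrix_mem_span Φ hJZ ?_
    rw [Subalgebra.mem_centralizer_iff]
    intro g hg
    apply Matrix.toLin'.injective
    refine LinearMap.ext fun v ↦ ?_
    rw [Matrix.toLin'_apply, Matrix.toLin'_apply, ← Matrix.mulVec_mulVec, ← Matrix.mulVec_mulVec, he, he,
      ← hsmul ⟨g, hg⟩, ← hsmul ⟨g, hg⟩]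
    exact (hRZ x hx _ _).symm
  · -- reduced: `T' ≅ R`
    haveI : IsReduced R := hRred
    exact isReduced_of_injective (Subalgebra.equivMapOfInjective R (e : Module.End ℚ (ι → ℚ) →ₐ[ℚ]
      Matrix ι ι ℚ) e.injective).symm (AlgEquiv.injective _)
  · -- commutative
    intro a ha b hb
    obtain ⟨x, hx, rfl⟩ := hmemT'.1 ha
    obtain ⟨y, hy, rfl⟩ := hmemT'.1 hb
    rw [← map_mul, ← map_mul, hRcomm x hx y hy]
  · -- dimension `= dim_ℚ V = #ι`
    rw [← (Subalgebra.equivMapOfInjective R (e : Module.End ℚ (ι → ℚ) →ₐ[ℚ] Matrix ι ι ℚ)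
      e.injective).toLinearEquiv.finrank_eq, hRdim, Module.finrank_fintype_fun_eq_card]
  · -- `†`-stable: the adjoint inside `R` IS the Rosati involution (`B` non-degenerate)
    intro a ha
    obtain ⟨x, hx, rfl⟩ := hmemT'.1 ha
    obtain ⟨y, hy, hxy⟩ := hRadj x hx
    suffices h : rosati G (e x) = e y by rw [h]; exact hmemT'.2 ⟨y, hy, rfl⟩
    rw [Matrix.ext_iff_mulVec]
    intro w
    refine sub_eq_zero.1 (hBnd.2 _ fun v ↦ ?_)
    rw [map_sub, ← toBilin_apply_mulVec_eq hG, he, he, hxy, sub_self]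

/-- The two conditions are equivalent (the converse is trivial). [cite: MilneCM2006, Ch. I §3 Prop. 3.6 (c)] -/
theorem exists_comm_isReduced_rosati_stable_le_endAlgRat_iff {G : Matrix ι ι ℚ} (hG : IsUnit G.det)
    (hGt : G.transpose = -G) (hE : ∀ a ∈ endAlgRat Φ, rosati G a ∈ endAlgRat Φ) :
    (∃ T : Subalgebra ℚ (Matrix ι ι ℚ), T ≤ endAlgRat Φ ∧ IsReduced T ∧ (∀ a ∈ T, ∀ b ∈ T, a * b = b * a) ∧
      finrank ℚ T = Fintype.card ι ∧ ∀ a ∈ T, rosati G a ∈ T) ↔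
    ∃ T : Subalgebra ℚ (Matrix ι ι ℚ), T ≤ endAlgRat Φ ∧ IsReduced T ∧ (∀ a ∈ T, ∀ b ∈ T, a * b = b * a) ∧
      finrank ℚ T = Fintype.card ι :=
  ⟨fun ⟨T, hTE, hred, hcomm, hdim, _⟩ ↦ ⟨T, hTE, hred, hcomm, hdim⟩,
    exists_comm_isReduced_rosati_stable_le_endAlgRat Φ hG hGt hE⟩

/-! ## §3 For a polarised complex torus / an abelian variety -/

variable {Φ}

/-- **For a polarised complex torus `(X, η)` of CM type and ANY rational Gram matrix `G` of `η`: `End_ℚ(X)`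
contains a commutative semisimple `ℚ`-algebra of dimension `2g` STABLE UNDER THE ROSATI INVOLUTION OF `η`**
(`End_ℚ(X)` is `†_η`-stable by Lemma 2.4.1, the tree's `rosati_mem_endAlgRat`; `G` is alternating and
non-degenerate). [cite: MilneCM2006, Ch. I §3 Prop. 3.6 (c) and Exercise 3.10 (b)] [cite: Lange2023AbelianVarietiesComplex, §2.4.1 Lemma 2.4.1] -/
theorem IsRiemannForm.exists_comm_isReduced_rosati_stable_le_endAlgRat {η : E [⋀^Fin 2]→L[ℝ] ℝ}
    (hη : IsRiemannForm Φ η) {G : Matrix ι ι ℚ} (hGr : G.map (Rat.cast : ℚ → ℝ) = latticeGram Φ η)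
    (hex : ∃ T : Subalgebra ℚ (Matrix ι ι ℚ), T ≤ endAlgRat Φ ∧ IsReduced T ∧ (∀ a ∈ T, ∀ b ∈ T, a * b = b * a) ∧
      finrank ℚ T = Fintype.card ι) :
    ∃ T : Subalgebra ℚ (Matrix ι ι ℚ), T ≤ endAlgRat Φ ∧ IsReduced T ∧ (∀ a ∈ T, ∀ b ∈ T, a * b = b * a) ∧
      finrank ℚ T = Fintype.card ι ∧ ∀ a ∈ T, rosati G a ∈ T :=
  ComplexTorus.exists_comm_isReduced_rosati_stable_le_endAlgRat Φ
    (isUnit_det_of_map_ratCast hGr hη.isUnit_det_latticeGram) (transpose_eq_neg_of_map_ratCast Φ hGr)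
    (fun _ ha ↦ rosati_mem_endAlgRat Φ hη.1 hη.2.2 hGr ha) hex

/-- ★ **PROPOSITION 7.2.6 WITH THE ROSATI CLAUSE, for a polarised complex torus `(X, η)` and any rational Gram
matrix `G` of `η`: `Hg(X)(ℂ)` is commutative iff `End_ℚ(X)` contains a commutative semisimple `ℚ`-algebra of
dimension `2g` which is STABLE under the Rosati involution `†_η`** — «which can be chosen to be a CM-algebra
invariant under [the] Rosati involution». [cite: MilneCM2006, Ch. I §3 Prop. 3.6 (c) and Exercise 3.10 (b)]
[cite: Lange2023AbelianVarietiesComplex, §7.2.3 Prop. 7.2.6] -/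
theorem IsRiemannForm.hodgeGroupC_comm_iff_exists_rosati_stable {η : E [⋀^Fin 2]→L[ℝ] ℝ}
    (hη : IsRiemannForm Φ η) {G : Matrix ι ι ℚ} (hGr : G.map (Rat.cast : ℚ → ℝ) = latticeGram Φ η) :
    (∀ M ∈ hodgeGroupC Φ, ∀ N ∈ hodgeGroupC Φ, M * N = N * M) ↔
      ∃ T : Subalgebra ℚ (Matrix ι ι ℚ), T ≤ endAlgRat Φ ∧ IsReduced T ∧ (∀ a ∈ T, ∀ b ∈ T, a * b = b * a) ∧
        finrank ℚ T = Fintype.card ι ∧ ∀ a ∈ T, rosati G a ∈ T := by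
  rw [hη.hodgeGroupC_comm_iff_exists_comm_isReduced_le_endAlgRat]
  exact ⟨hη.exists_comm_isReduced_rosati_stable_le_endAlgRat hGr,
    fun ⟨T, hTE, hred, hcomm, hdim, _⟩ ↦ ⟨T, hTE, hred, hcomm, hdim⟩⟩

/-- The same with `J`: for a polarised torus, `J ∈ End_ℚ(X) ⊗ ℝ` iff `End_ℚ(X)` contains a `†_η`-stable
commutative semisimple `ℚ`-algebra of dimension `2g`. [cite: MilneCM2006, Ch. I §3 Prop. 3.6 (c)]
[cite: Lange2023AbelianVarietiesComplex, §7.2.3 Prop. 7.2.6 (proof)] -/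
theorem IsRiemannForm.jMatrix_mem_span_iff_exists_rosati_stable {η : E [⋀^Fin 2]→L[ℝ] ℝ}
    (hη : IsRiemannForm Φ η) {G : Matrix ι ι ℚ} (hGr : G.map (Rat.cast : ℚ → ℝ) = latticeGram Φ η) :
    jMatrix Φ ∈ Submodule.span ℝ ((fun A : Matrix ι ι ℚ ↦ A.map (Rat.cast : ℚ → ℝ)) ''
        (endAlgRat Φ : Set (Matrix ι ι ℚ))) ↔
      ∃ T : Subalgebra ℚ (Matrix ι ι ℚ), T ≤ endAlgRat Φ ∧ IsReduced T ∧ (∀ a ∈ T, ∀ b ∈ T, a * b = b * a) ∧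
        finrank ℚ T = Fintype.card ι ∧ ∀ a ∈ T, rosati G a ∈ T := by
  rw [← hη.exists_comm_isReduced_le_endAlgRat_iff_jMatrix_mem_span]
  exact ⟨hη.exists_comm_isReduced_rosati_stable_le_endAlgRat hGr,
    fun ⟨T, hTE, hred, hcomm, hdim, _⟩ ↦ ⟨T, hTE, hred, hcomm, hdim⟩⟩

end ComplexTorus

end Literature.Geometry.Kaehler
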